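import Summits.Ventures.PercRepro.RankLevelSetRuleQNineCoreDefs
/-!
# PercRepro — THE CORE (definitions, the key identity) OF THE FAMILY `k = 9` ON ITS WHOLE UNTRUNCATED REGIME, FOR EVERY `q` (p4, gen 25; C-044; paper
proofs/P4-CELL-THREE.md §13.5, §13.7)

**`rhat_nine_whole (q m : ℕ) (hm : m + 8 ≤ q) : phiK (q + 9) q ≤ rhat q 9 m`** (RankLevelSetRuleQNineWhole) — Rule Q's equal split pays `Φ(q+9, q)` to
EVERY member of EVERY cell `(q+9, q)` with `#P ≤ q − 8` (the whole untruncated regime `u = q − #P ≥ k − 1`), uniformly in `q`.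
This module proves the key identity `(R̂(q,9,m) − Φ(q+9,q))·den = na·S(q,m) + nb` (**`rhat_nine_key`**) with the master sum `S` of
RankLevelSetRuleQSumS.  Same mathematics as RankLevelSetRuleQEightCore; the proof is organised so that no `ring` call ever multiplies
the denominator into the `W`-sum (the gen-24 form exhausted the kernel's memory at `k = 9`): the recurrence is folded into the chain
`D_j·S(m+j) = A_j·S(m) + B_j` (`D_j = Π_{l≤j}(q+m+l)`), each forward difference `W_i` is handled by its own lemma, the binomial
weights are multiplied in one difference at a time, and the final assembly is a lemma over atoms (`nine_final`).  No `sorry`; axioms standard.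
-/

namespace PercRepro

open Finset
/-- `C(n,8) = n(n−1)⋯(n−7)/40320` in `ℚ`. -/
lemma choose_eight_cast (n : ℕ) (hn : 7 ≤ n) : (n.choose 8 : ℚ) = (n : ℚ) * (n - 1) * (n - 2) * (n - 3) * (n - 4) * (n - 5) * (n - 6) * (n - 7) / 40320 := by
  have h := Nat.descFactorial_eq_factorial_mul_choose n 8
  have hd : n.descFactorial 8 = (n - 7) * ((n - 6) * ((n - 5) * ((n - 4) * ((n - 3) * ((n - 2) * ((n - 1) * (n))))))) := by
    simp only [Nat.descFactorial_succ, Nat.descFactorial_zero, mul_one, Nat.sub_zero]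
  rw [hd] at h
  have h' : (((n - 7) * ((n - 6) * ((n - 5) * ((n - 4) * ((n - 3) * ((n - 2) * ((n - 1) * (n))))))) : ℕ) : ℚ) = ((Nat.factorial 8 * n.choose 8 : ℕ) : ℚ) := by rw [h]
  push_cast [Nat.cast_sub (show 7 ≤ n by omega), Nat.cast_sub (show 6 ≤ n by omega), Nat.cast_sub (show 5 ≤ n by omega), Nat.cast_sub (show 4 ≤ n by omega), Nat.cast_sub (show 3 ≤ n by omega), Nat.cast_sub (show 2 ≤ n by omega), Nat.cast_sub (show 1 ≤ n by omega)] at h'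
  have hf : (Nat.factorial 8 : ℚ) = 40320 := by norm_num [Nat.factorial]
  rw [hf] at h'
  linarith
/-- `W_8 = Σ_i (−1)^(8−i) C(8,i)·S(m+i)`. -/
lemma sumW_eight (q m : ℕ) :
    sumW q m 8 = sumS q (m + 8) - 8 * sumS q (m + 7) + 28 * sumS q (m + 6) - 56 * sumS q (m + 5) + 70 * sumS q (m + 4) - 56 * sumS q (m + 3) + 28 * sumS q (m + 2) - 8 * sumS q (m + 1) + sumS q m := by
  rw [sumW_succ, sumW_seven, sumW_seven, show m + 1 + 1 = m + 2 from rfl, show m + 1 + 2 = m + 3 from rfl, show m + 1 + 3 = m + 4 from rfl, show m + 1 + 4 = m + 5 from rfl, show m + 1 + 5 = m + 6 from rfl, show m + 1 + 6 = m + 7 from rfl, show m + 1 + 7 = m + 8 from rfl]; ring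

-- [core:w_eq]
set_option maxHeartbeats 3200000 in
set_option maxRecDepth 8192 in
/-- The `W`-part of `R̂ − Φ` at `k = 9`, with the recurrence substituted: `D·Σ_i 8!·C(n,i)·W_i = pwX·X + pw0`, a polynomial in
`(q, m, X = S(q,m))`; `n = q + 9 − m`, `D = Π_{l≤8}(q+m+l)` are carried as variables so that every `ring` call stays small. -/
lemma nine_w_eq (q m X S1 S2 S3 S4 S5 S6 S7 S8 n D : ℚ) (hn : n = q + 9 - m) (hD : D = (q + m + 1) * (q + m + 2) * (q + m + 3) * (q + m + 4) * (q + m + 5) * (q + m + 6) * (q + m + 7) * (q + m + 8)) (h1 : (q + m + 1) * S1 = 2 * (m + 1) * X + q) (h2 : (q + m + 2) * S2 = 2 * (m + 2) * S1 + q) (h3 : (q + m + 3) * S3 = 2 * (m + 3) * S2 + q) (h4 : (q + m + 4) * S4 = 2 * (m + 4) * S3 + q) (h5 : (q + m + 5) * S5 = 2 * (m + 5) * S4 + q) (h6 : (q + m + 6) * S6 = 2 * (m + 6) * S5 + q) (h7 : (q + m + 7) * S7 = 2 * (m + 7) * S6 + q) (h8 : (q + m + 8) * S8 = 2 * (m +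 8) * S7 + q) :
    D * (40320 * (n) * (S1 - X) + 20160 * (n * (n - 1)) * (S2 - 2 * S1 + X) + 6720 * (n * (n - 1) * (n - 2)) * (S3 - 3 * S2 + 3 * S1 - X) + 1680 * (n * (n - 1) * (n - 2) * (n - 3)) * (S4 - 4 * S3 + 6 * S2 - 4 * S1 + X) + 336 * (n * (n - 1) * (n - 2) * (n - 3) * (n - 4)) * (S5 - 5 * S4 + 10 * S3 - 10 * S2 + 5 * S1 - X) + 56 * (n * (n - 1) * (n - 2) * (n - 3) * (n - 4) * (n - 5)) * (S6 - 6 * S5 + 15 * S4 - 20 * S3 + 15 * S2 - 6 * S1 + X) + 8 * (n * (n - 1) * (n - 2) * (n - 3) * (n - 4) * (n - 5) * (n - 6)) * (S7 - 7 * S6 + 21 * S5 - 35 * S4 + 35 * S3 - 21 * S2 + 7 * S1 - X) + 1 * (n * (n - 1) * (n - 2) * (n - 3) * (n - 4) * (n - 5) * (n - 6) * (n - 7)) * (S8 - 8 * S7 + 28 * S6 - 56 * S5 + 70 * S4 - 56 * S3 + 28 * S2 - 8 * S1 + X))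
    = ninePwX q m * X + ninePw0 q m := by
  have hc1 : (q + m + 1) * S1 = (2 * (m + 1)) * X + (((1 : ℚ) * q)) := by linear_combination h1
  have hc2 : (q + m + 1) * (q + m + 2) * S2 = (4 * (m + 1) * (m + 2)) * X + (((5 : ℚ) * q + (1 : ℚ) * q ^ 2) + ((3 : ℚ) * q) * m) := by
    linear_combination ((q + m + 1)) * h2 + (2 * (m + 2)) * hc1
  have hc3 : (q + m + 1) * (q + m + 2) * (q + m + 3) * S3 = (8 * (m + 1) * (m + 2) * (m + 3)) * X + (((32 : ℚ) * q + (9 : ℚ) * q ^ 2 + (1 : ℚ) * q ^ 3) + ((31 : ℚ) * q + (4 : ℚ) * q ^ 2) * m + ((7 : ℚ) * q) * m ^ 2) := by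
    linear_combination ((q + m + 1) * (q + m + 2)) * h3 + (2 * (m + 3)) * hc2
  have hc4 : (q + m + 1) * (q + m + 2) * (q + m + 3) * (q + m + 4) * S4 = (16 * (m + 1) * (m + 2) * (m + 3) * (m + 4)) * X + (((262 : ℚ) * q + (83 : ℚ) * q ^ 2 + (14 : ℚ) * q ^ 3 + (1 : ℚ) * q ^ 4) + ((323 : ℚ) * q + (62 : ℚ) * q ^ 2 + (5 : ℚ) * q ^ 3) * m + ((124 : ℚ) * q + (11 : ℚ) * q ^ 2) * m ^ 2 + ((15 : ℚ) * q) * m ^ 3) := by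
    linear_combination ((q + m + 1) * (q + m + 2) * (q + m + 3)) * h4 + (2 * (m + 4)) * hc3
  have hc5 : (q + m + 1) * (q + m + 2) * (q + m + 3) * (q + m + 4) * (q + m + 5) * S5 = (32 * (m + 1) * (m + 2) * (m + 3) * (m + 4) * (m + 5)) * X + (((2644 : ℚ) * q + (880 : ℚ) * q ^ 2 + (175 : ℚ) * q ^ 3 + (20 : ℚ) * q ^ 4 + (1 : ℚ) * q ^ 5) + ((3804 : ℚ) * q + (856 : ℚ) * q ^ 2 + (108 : ℚ) * q ^ 3 + (6 : ℚ) * q ^ 4) * m + ((1921 : ℚ) * q + (264 : ℚ) * q ^ 2 + (16 : ℚ) * q ^ 3) * m ^ 2 + ((408 : ℚ) * q + (26 : ℚ) * q ^ 2) * m ^ 3 + ((31 : ℚ) * q) * m ^ 4) := by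
    linear_combination ((q + m + 1) * (q + m + 2) * (q + m + 3) * (q + m + 4)) * h5 + (2 * (m + 5)) * hc4
  have hc6 : (q + m + 1) * (q + m + 2) * (q + m + 3) * (q + m + 4) * (q + m + 5) * (q + m + 6) * S6 = (64 * (m + 1) * (m + 2) * (m + 3) * (m + 4) * (m + 5) * (m + 6)) * X + (((31848 : ℚ) * q + (10834 : ℚ) * q ^ 2 + (2325 : ℚ) * q ^ 3 + (325 : ℚ) * q ^ 4 + (27 : ℚ) * q ^ 5 + (1 : ℚ) * q ^ 6) + ((51210 : ℚ) * q + (12482 : ℚ) * q ^ 2 + (1901 : ℚ) * q ^ 3 + (172 : ℚ) * q ^ 4 + (7 : ℚ) * q ^ 5) * m + ((30885 : ℚ) * q + (5135 : ℚ) * q ^ 2 + (498 : ℚ) * q ^ 3 + (22 : ℚ) * q ^ 4) * m ^ 2 + ((8823 : ℚ) * q + (900 : ℚ) * q ^ 2 + (42 : ℚ) * q ^ 3) * m ^ 3 + ((1203 : ℚ) * q + (57 : ℚ) * q ^ 2) * m ^ 4 + ((63 : ℚ) * q) * m ^ 5) := by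
    linear_combination ((q + m + 1) * (q + m + 2) * (q + m + 3) * (q + m + 4) * (q + m + 5)) * h6 + (2 * (m + 6)) * hc5
  have hc7 : (q + m + 1) * (q + m + 2) * (q + m + 3) * (q + m + 4) * (q + m + 5) * (q + m + 6) * (q + m + 7) * S7 = (128 * (m + 1) * (m + 2) * (m + 3) * (m + 4) * (m + 5) * (m + 6) * (m + 7)) * X + (((446592 : ℚ) * q + (153440 : ℚ) * q ^ 2 + (34174 : ℚ) * q ^ 3 + (5285 : ℚ) * q ^ 4 + (553 : ℚ) * q ^ 5 + (35 : ℚ) * q ^ 6 + (1 : ℚ) * q ^ 7) + ((782400 : ℚ) * q + (199664 : ℚ) * q ^ 2 + (33469 : ℚ) * q ^ 3 + (3758 : ℚ) * q ^ 4 + (257 : ℚ) * q ^ 5 + (8 : ℚ) * q ^ 6) * m + ((536434 : ℚ) * q + (99059 : ℚ) * q ^ 2 + (11824 : ℚ) * q ^ 3 + (862 : ℚ) * q ^ 4 + (29 : ℚ) * q ^ 5) * m ^ 2 + ((186027 : ℚ) * q + (23570 : ℚ) * q ^ 2 + (1794 : ℚ) * q ^ 3 + (64 : ℚ) * q ^ 4)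 * m ^ 3 + ((34663 : ℚ) * q + (2703 : ℚ) * q ^ 2 + (99 : ℚ) * q ^ 3) * m ^ 4 + ((3309 : ℚ) * q + (120 : ℚ) * q ^ 2) * m ^ 5 + ((127 : ℚ) * q) * m ^ 6) := by
    linear_combination ((q + m + 1) * (q + m + 2) * (q + m + 3) * (q + m + 4) * (q + m + 5) * (q + m + 6)) * h7 + (2 * (m + 7)) * hc6
  have hc8 : (q + m + 1) * (q + m + 2) * (q + m + 3) * (q + m + 4) * (q + m + 5) * (q + m + 6) * (q + m + 7) * (q + m + 8) * S8 = (256 * (m + 1) * (m + 2) * (m + 3) * (m + 4) * (m + 5) * (m + 6) * (m + 7) * (m + 8)) * X + (((7150512 : ℚ) * q + (2468108 : ℚ) * q ^ 2 + (559916 : ℚ) * q ^ 3 + (91329 : ℚ) * q ^ 4 + (10808 : ℚ) * q ^ 5 + (882 : ℚ) * q ^ 6 + (44 : ℚ) * q ^ 7 + (1 : ℚ) * q ^ 8) + ((13424652 : ℚ) * q + (3527768 : ℚ) * q ^ 2 + (624159 : ℚ) * q ^ 3 + (78538 : ℚ) * q ^ 4 + (6828 : ℚ) * q ^ 5 + (366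 : ℚ) * q ^ 6 + (9 : ℚ) * q ^ 7) * m + ((10160876 : ℚ) * q + (2004579 : ℚ) * q ^ 2 + (267882 : ℚ) * q ^ 3 + (24528 : ℚ) * q ^ 4 + (1398 : ℚ) * q ^ 5 + (37 : ℚ) * q ^ 6) * m ^ 2 + ((4056069 : ℚ) * q + (583078 : ℚ) * q ^ 2 + (55572 : ℚ) * q ^ 3 + (3308 : ℚ) * q ^ 4 + (93 : ℚ) * q ^ 5) * m ^ 3 + ((928622 : ℚ) * q + (91998 : ℚ) * q ^ 2 + (5592 : ℚ) * q ^ 3 + (163 : ℚ) * q ^ 4) * m ^ 4 + ((122592 : ℚ) * q + (7494 : ℚ) * q ^ 2 + (219 : ℚ) * q ^ 3) * m ^ 5 + ((8678 : ℚ) * q + (247 : ℚ) * q ^ 2) * m ^ 6 + ((255 : ℚ) * q) * m ^ 7) := by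
    linear_combination ((q + m + 1) * (q + m + 2) * (q + m + 3) * (q + m + 4) * (q + m + 5) * (q + m + 6) * (q + m + 7)) * h8 + (2 * (m + 8)) * hc7
  have hW1 : D * (S1 - X) = nineAlpha1 q m * X + nineBeta1 q m := by
    rw [hD]; unfold nineAlpha1 nineBeta1; linear_combination (1) * ((q + m + 2) * (q + m + 3) * (q + m + 4) * (q + m + 5) * (q + m + 6) * (q + m + 7) * (q + m + 8)) * hc1
  have hW2 : D * (S2 - 2 * S1 + X) = nineAlpha2 q m * X + nineBeta2 q m := by
    rw [hD]; unfold nineAlpha2 nineBeta2; linear_combination (-2) * ((q + m + 2) * (q + m + 3) * (q + m + 4) * (q + m + 5) * (q + m + 6) * (q + m + 7) * (q + m + 8)) * hc1 + (1) * ((q + m + 3) * (q + m + 4) * (q + m + 5) * (q + m + 6) * (q + m + 7) * (q + m + 8)) * hc2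
  have hW3 : D * (S3 - 3 * S2 + 3 * S1 - X) = nineAlpha3 q m * X + nineBeta3 q m := by
    rw [hD]; unfold nineAlpha3 nineBeta3; linear_combination (3) * ((q + m + 2) * (q + m + 3) * (q + m + 4) * (q + m + 5) * (q + m + 6) * (q + m + 7) * (q + m + 8)) * hc1 + (-3) * ((q + m + 3) * (q + m + 4) * (q + m + 5) * (q + m + 6) * (q + m + 7) * (q + m + 8)) * hc2 + (1) * ((q + m + 4) * (q + m + 5) * (q + m + 6) * (q + m + 7) * (q + m + 8)) * hc3
  have hW4 : D * (S4 - 4 * S3 + 6 * S2 - 4 * S1 + X) = nineAlpha4 q m * X + nineBeta4 q m := by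
    rw [hD]; unfold nineAlpha4 nineBeta4; linear_combination (-4) * ((q + m + 2) * (q + m + 3) * (q + m + 4) * (q + m + 5) * (q + m + 6) * (q + m + 7) * (q + m + 8)) * hc1 + (6) * ((q + m + 3) * (q + m + 4) * (q + m + 5) * (q + m + 6) * (q + m + 7) * (q + m + 8)) * hc2 + (-4) * ((q + m + 4) * (q + m + 5) * (q + m + 6) * (q + m + 7) * (q + m + 8)) * hc3 + (1) * ((q + m + 5) * (q + m + 6) * (q + m + 7) * (q + m + 8)) * hc4
  have hW5 : D * (S5 - 5 * S4 + 10 * S3 - 10 * S2 + 5 * S1 - X) = nineAlpha5 q m * X + nineBeta5 q m := by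
    rw [hD]; unfold nineAlpha5 nineBeta5; linear_combination (5) * ((q + m + 2) * (q + m + 3) * (q + m + 4) * (q + m + 5) * (q + m + 6) * (q + m + 7) * (q + m + 8)) * hc1 + (-10) * ((q + m + 3) * (q + m + 4) * (q + m + 5) * (q + m + 6) * (q + m + 7) * (q + m + 8)) * hc2 + (10) * ((q + m + 4) * (q + m + 5) * (q + m + 6) * (q + m + 7) * (q + m + 8)) * hc3 + (-5) * ((q + m + 5) * (q + m + 6) * (q + m + 7) * (q + m + 8)) * hc4 + (1) * ((q + m + 6) * (q + m + 7) * (q + m + 8)) * hc5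
  have hW6 : D * (S6 - 6 * S5 + 15 * S4 - 20 * S3 + 15 * S2 - 6 * S1 + X) = nineAlpha6 q m * X + nineBeta6 q m := by
    rw [hD]; unfold nineAlpha6 nineBeta6; linear_combination (-6) * ((q + m + 2) * (q + m + 3) * (q + m + 4) * (q + m + 5) * (q + m + 6) * (q + m + 7) * (q + m + 8)) * hc1 + (15) * ((q + m + 3) * (q + m + 4) * (q + m + 5) * (q + m + 6) * (q + m + 7) * (q + m + 8)) * hc2 + (-20) * ((q + m + 4) * (q + m + 5) * (q + m + 6) * (q + m + 7) * (q + m + 8)) * hc3 + (15) * ((q + m + 5) * (q + m + 6) * (q + m + 7) * (q + m + 8)) * hc4 + (-6) * ((q + m + 6) * (q + m + 7) * (q + m + 8)) * hc5 + (1) * ((q + m + 7) * (q + m + 8)) * hc6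
  have hW7 : D * (S7 - 7 * S6 + 21 * S5 - 35 * S4 + 35 * S3 - 21 * S2 + 7 * S1 - X) = nineAlpha7 q m * X + nineBeta7 q m := by
    rw [hD]; unfold nineAlpha7 nineBeta7; linear_combination (7) * ((q + m + 2) * (q + m + 3) * (q + m + 4) * (q + m + 5) * (q + m + 6) * (q + m + 7) * (q + m + 8)) * hc1 + (-21) * ((q + m + 3) * (q + m + 4) * (q + m + 5) * (q + m + 6) * (q + m + 7) * (q + m + 8)) * hc2 + (35) * ((q + m + 4) * (q + m + 5) * (q + m + 6) * (q + m + 7) * (q + m + 8)) * hc3 + (-35) * ((q + m + 5) * (q + m + 6) * (q + m + 7) * (q + m + 8)) * hc4 + (21) * ((q + m + 6) * (q + m + 7) * (q + m + 8)) * hc5 + (-7) * ((q + m + 7) * (q + m + 8)) * hc6 + (1) * ((q + m + 8)) * hc7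
  have hW8 : D * (S8 - 8 * S7 + 28 * S6 - 56 * S5 + 70 * S4 - 56 * S3 + 28 * S2 - 8 * S1 + X) = nineAlpha8 q m * X + nineBeta8 q m := by
    rw [hD]; unfold nineAlpha8 nineBeta8; linear_combination (-8) * ((q + m + 2) * (q + m + 3) * (q + m + 4) * (q + m + 5) * (q + m + 6) * (q + m + 7) * (q + m + 8)) * hc1 + (28) * ((q + m + 3) * (q + m + 4) * (q + m + 5) * (q + m + 6) * (q + m + 7) * (q + m + 8)) * hc2 + (-56) * ((q + m + 4) * (q + m + 5) * (q + m + 6) * (q + m + 7) * (q + m + 8)) * hc3 + (70) * ((q + m + 5) * (q + m + 6) * (q + m + 7) * (q + m + 8)) * hc4 + (-56) * ((q + m + 6) * (q + m + 7) * (q + m + 8)) * hc5 + (28) * ((q + m + 7) * (q + m + 8)) * hc6 + (-8) * ((q + m + 8)) * hc7 + (1) * hc8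
  have hg1 : 40320 * (n) * (nineAlpha1 q m * X + nineBeta1 q m) = nineGamma1 q m * X + nineDelta1 q m := by
    rw [hn]; unfold nineAlpha1 nineBeta1 nineGamma1 nineDelta1; ring
  have hg2 : 20160 * (n * (n - 1)) * (nineAlpha2 q m * X + nineBeta2 q m) = nineGamma2 q m * X + nineDelta2 q m := by
    rw [hn]; unfold nineAlpha2 nineBeta2 nineGamma2 nineDelta2; ring
  have hg3 : 6720 * (n * (n - 1) * (n - 2)) * (nineAlpha3 q m * X + nineBeta3 q m) = nineGamma3 q m * X + nineDelta3 q m := by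
    rw [hn]; unfold nineAlpha3 nineBeta3 nineGamma3 nineDelta3; ring
  have hg4 : 1680 * (n * (n - 1) * (n - 2) * (n - 3)) * (nineAlpha4 q m * X + nineBeta4 q m) = nineGamma4 q m * X + nineDelta4 q m := by
    rw [hn]; unfold nineAlpha4 nineBeta4 nineGamma4 nineDelta4; ring
  have hg5 : 336 * (n * (n - 1) * (n - 2) * (n - 3) * (n - 4)) * (nineAlpha5 q m * X + nineBeta5 q m) = nineGamma5 q m * X + nineDelta5 q m := by
    rw [hn]; unfold nineAlpha5 nineBeta5 nineGamma5 nineDelta5; ring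
  have hg6 : 56 * (n * (n - 1) * (n - 2) * (n - 3) * (n - 4) * (n - 5)) * (nineAlpha6 q m * X + nineBeta6 q m) = nineGamma6 q m * X + nineDelta6 q m := by
    rw [hn]; unfold nineAlpha6 nineBeta6 nineGamma6 nineDelta6; ring
  have hg7 : 8 * (n * (n - 1) * (n - 2) * (n - 3) * (n - 4) * (n - 5) * (n - 6)) * (nineAlpha7 q m * X + nineBeta7 q m) = nineGamma7 q m * X + nineDelta7 q m := by
    rw [hn]; unfold nineAlpha7 nineBeta7 nineGamma7 nineDelta7; ring
  have hg8 : 1 * (n * (n - 1) * (n - 2) * (n - 3) * (n - 4) * (n - 5) * (n - 6) * (n - 7)) * (nineAlpha8 q m * X + nineBeta8 q m) = nineGamma8 q m * X + nineDelta8 q m := by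
    rw [hn]; unfold nineAlpha8 nineBeta8 nineGamma8 nineDelta8; ring
  have hsplit : D * (40320 * (n) * (S1 - X) + 20160 * (n * (n - 1)) * (S2 - 2 * S1 + X) + 6720 * (n * (n - 1) * (n - 2)) * (S3 - 3 * S2 + 3 * S1 - X) + 1680 * (n * (n - 1) * (n - 2) * (n - 3)) * (S4 - 4 * S3 + 6 * S2 - 4 * S1 + X) + 336 * (n * (n - 1) * (n - 2) * (n - 3) * (n - 4)) * (S5 - 5 * S4 + 10 * S3 - 10 * S2 + 5 * S1 - X) + 56 * (n * (n - 1) * (n - 2) * (n - 3) * (n - 4) * (n - 5)) * (S6 - 6 * S5 + 15 * S4 - 20 * S3 + 15 * S2 - 6 * S1 + X) + 8 * (n * (n - 1) * (n - 2) * (n - 3) * (n - 4) * (n - 5) * (n - 6)) * (S7 - 7 * S6 + 21 * S5 - 35 * S4 + 35 * S3 - 21 * S2 + 7 * S1 - X) + 1 * (n * (n - 1) * (n - 2) * (n - 3) * (n - 4) * (n - 5) * (n - 6) * (n - 7)) * (S8 - 8 * S7 + 28 * S6 - 56 * S5 + 70 * S4 - 56 * S3 + 28 * S2 - 8 * S1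 + X)) = 40320 * (n) * (D * (S1 - X)) + 20160 * (n * (n - 1)) * (D * (S2 - 2 * S1 + X)) + 6720 * (n * (n - 1) * (n - 2)) * (D * (S3 - 3 * S2 + 3 * S1 - X)) + 1680 * (n * (n - 1) * (n - 2) * (n - 3)) * (D * (S4 - 4 * S3 + 6 * S2 - 4 * S1 + X)) + 336 * (n * (n - 1) * (n - 2) * (n - 3) * (n - 4)) * (D * (S5 - 5 * S4 + 10 * S3 - 10 * S2 + 5 * S1 - X)) + 56 * (n * (n - 1) * (n - 2) * (n - 3) * (n - 4) * (n - 5)) * (D * (S6 - 6 * S5 + 15 * S4 - 20 * S3 + 15 * S2 - 6 * S1 + X)) + 8 * (n * (n - 1) * (n - 2) * (n - 3) * (n - 4) * (n - 5) * (n - 6)) * (D * (S7 - 7 * S6 + 21 * S5 - 35 * S4 + 35 * S3 - 21 * S2 + 7 * S1 - X)) + 1 * (n * (n - 1) * (n - 2) * (n - 3) * (n - 4) * (n - 5) * (n - 6) * (n - 7)) * (D * (S8 - 8 * S7 + 28 * S6 - 56 * S5 + 70 * S4 - 56 * S3 + 28 * S2 - 8 * S1 + X)) := by ring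
  rw [hsplit, hW1, hW2, hW3, hW4, hW5, hW6, hW7, hW8, hg1, hg2, hg3, hg4, hg5, hg6, hg7, hg8]
  unfold nineGamma1 nineDelta1 nineGamma2 nineDelta2 nineGamma3 nineDelta3 nineGamma4 nineDelta4 nineGamma5 nineDelta5 nineGamma6 nineDelta6 nineGamma7 nineDelta7 nineGamma8 nineDelta8 ninePwX ninePw0; ring

/-- The `Φ`-part at `k = 9`: `Σ_{J=1}^{8} C(q+9,J)/C(q+J,J)` times `Π_{J≤8}(q+J)` is a polynomial in `q`. -/
lemma nine_phi_eq (q : ℕ) :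
    (∑ J ∈ Ioo 0 9, ((q + 9).choose J : ℚ) / ((q + J).choose J : ℚ)) * ((q + 1) * (q + 2) * (q + 3) * (q + 4) * (q + 5) * (q + 6) * (q + 7) * (q + 8))
      = ninePPhi q := by
  unfold ninePPhi
  rw [show Finset.Ioo 0 9 = {1, 2, 3, 4, 5, 6, 7, 8} from by decide]
  rw [Finset.sum_insert (by decide), Finset.sum_insert (by decide), Finset.sum_insert (by decide), Finset.sum_insert (by decide), Finset.sum_insert (by decide), Finset.sum_insert (by decide), Finset.sum_insert (by decide),
    Finset.sum_singleton]
  rw [Nat.choose_one_right, Nat.choose_one_right, choose_two_cast (q + 9) (by omega), choose_two_cast (q + 2) (by omega), choose_three_cast (q + 9) (by omega), choose_three_cast (q + 3) (by omega), choose_four_cast (q + 9) (by omega), choose_four_cast (q + 4) (by omega), choose_five_cast (q + 9) (by omega), choose_five_cast (q + 5) (by omega), choose_six_cast (q + 9) (by omega), choose_six_cast (q + 6) (by omega), choose_seven_cast (q + 9) (by omega), choose_seven_cast (q + 7) (by omega), choose_eight_cast (q + 9) (by omega), choose_eight_cast (q + 8) (by omega)]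
  have hq1 : ((q : ℚ) + 1) ≠ 0 := by positivity
  have hq2 : ((q : ℚ) + 2) ≠ 0 := by positivity
  have hq3 : ((q : ℚ) + 3) ≠ 0 := by positivity
  have hq4 : ((q : ℚ) + 4) ≠ 0 := by positivity
  have hq5 : ((q : ℚ) + 5) ≠ 0 := by positivity
  have hq6 : ((q : ℚ) + 6) ≠ 0 := by positivity
  have hq7 : ((q : ℚ) + 7) ≠ 0 := by positivity
  have hq8 : ((q : ℚ) + 8) ≠ 0 := by positivity
  push_cast
  simp only [show ((q : ℚ) + 2 - 1) = q + 1 by ring, show ((q : ℚ) + 3 - 1) = q + 2 by ring, show ((q : ℚ) + 3 - 2) = q + 1 by ring, show ((q : ℚ) + 4 - 1) = q + 3 by ring, show ((q : ℚ) + 4 - 2) = q + 2 by ring, show ((q : ℚ) + 4 - 3) = q + 1 by ring, show ((q : ℚ) + 5 - 1) = q + 4 by ring, show ((q : ℚ) + 5 - 2) = q + 3 by ring, show ((q : ℚ) + 5 - 3) = q + 2 by ring, show ((q : ℚ) + 5 - 4) = q + 1 by ring, show ((q : ℚ) + 6 - 1) = q + 5 by ring, show ((q : ℚ) + 6 - 2)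 = q + 4 by ring, show ((q : ℚ) + 6 - 3) = q + 3 by ring, show ((q : ℚ) + 6 - 4) = q + 2 by ring, show ((q : ℚ) + 6 - 5) = q + 1 by ring, show ((q : ℚ) + 7 - 1) = q + 6 by ring, show ((q : ℚ) + 7 - 2) = q + 5 by ring, show ((q : ℚ) + 7 - 3) = q + 4 by ring, show ((q : ℚ) + 7 - 4) = q + 3 by ring, show ((q : ℚ) + 7 - 5) = q + 2 by ring, show ((q : ℚ) + 7 - 6) = q + 1 by ring, show ((q : ℚ) + 8 - 1) = q + 7 by ring, show ((q : ℚ) + 8 - 2) = q + 6 by ring, show ((q : ℚ) + 8 - 3) = q + 5 by ring, show ((q : ℚ) + 8 - 4) = q + 4 by ring, show ((q : ℚ) + 8 - 5) = q + 3 by ring, show ((q : ℚ) + 8 - 6) = q + 2 by ring, show ((q : ℚ) + 8 - 7) = q + 1 by ring, show ((q : ℚ) + 9 - 1) = q + 8 by ring, show ((q : ℚ) + 9 - 2) = q + 7 by ring, show ((q : ℚ) + 9 - 3) = q + 6 by ring, show ((q : ℚ) + 9 - 4) = q + 5 by ring, show ((q : ℚ) + 9 - 5) = q + 4 by ring, show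 ((q : ℚ) + 9 - 6) = q + 3 by ring, show ((q : ℚ) + 9 - 7) = q + 2 by ring]
  field_simp
  ring

/-- `Σ_{i ∈ Ioo 0 9} f i = f 1 + … + f 8`. -/
lemma sum_Ioo_nine (f : ℕ → ℚ) : ∑ i ∈ Ioo 0 9, f i = f 1 + f 2 + f 3 + f 4 + f 5 + f 6 + f 7 + f 8 := by
  rw [show Finset.Ioo 0 9 = {1, 2, 3, 4, 5, 6, 7, 8} from by decide]
  rw [Finset.sum_insert (by decide), Finset.sum_insert (by decide), Finset.sum_insert (by decide), Finset.sum_insert (by decide), Finset.sum_insert (by decide), Finset.sum_insert (by decide), Finset.sum_insert (by decide),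
    Finset.sum_singleton]
  ring

set_option maxHeartbeats 1600000 in
set_option maxRecDepth 8192 in
/-- The assembly of the key identity over atoms: from the `W`-identity and the `Φ`-identity,
`(Σ_i C(n,i)·W_i − φ)·(8!·D·E) = E·pwX·X + (E·pw0 − 8!·D·PΦ)`. -/
lemma nine_final (q m D E n φ X S1 S2 S3 S4 S5 S6 S7 S8 : ℚ)
    (hA : D * (40320 * (n) * (S1 - X) + 20160 * (n * (n - 1)) * (S2 - 2 * S1 + X) + 6720 * (n * (n - 1) * (n - 2)) * (S3 - 3 * S2 + 3 * S1 - X) + 1680 * (n * (n - 1) * (n - 2) * (n - 3)) * (S4 - 4 * S3 + 6 * S2 - 4 * S1 + X) + 336 * (n * (n - 1) * (n - 2) * (n - 3) * (n - 4)) * (S5 - 5 * S4 + 10 * S3 - 10 * S2 + 5 * S1 - X) + 56 * (n * (n - 1) * (n - 2) * (n - 3) * (n - 4) * (n - 5)) * (S6 - 6 * S5 + 15 * S4 - 20 * S3 + 15 * S2 - 6 * S1 + X) + 8 * (n * (n - 1) * (n - 2) * (n - 3) * (n - 4) * (n - 5) * (n - 6)) * (S7 - 7 * S6 + 21 * S5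 - 35 * S4 + 35 * S3 - 21 * S2 + 7 * S1 - X) + 1 * (n * (n - 1) * (n - 2) * (n - 3) * (n - 4) * (n - 5) * (n - 6) * (n - 7)) * (S8 - 8 * S7 + 28 * S6 - 56 * S5 + 70 * S4 - 56 * S3 + 28 * S2 - 8 * S1 + X)) = ninePwX q m * X + ninePw0 q m)
    (hB : φ * E = ninePPhi q) :
    (n * (S1 - X) + n * (n - 1) / 2 * (S2 - 2 * S1 + X) + n * (n - 1) * (n - 2) / 6 * (S3 - 3 * S2 + 3 * S1 - X) + n * (n - 1) * (n - 2) * (n - 3) / 24 * (S4 - 4 * S3 + 6 * S2 - 4 * S1 + X) + n * (n - 1) * (n - 2) * (n - 3) * (n - 4) / 120 * (S5 - 5 * S4 + 10 * S3 - 10 * S2 + 5 * S1 - X) + n * (n - 1) * (n - 2) * (n - 3) * (n - 4) * (n - 5) / 720 * (S6 - 6 * S5 + 15 * S4 - 20 * S3 + 15 * S2 - 6 * S1 + X) + n * (n - 1) * (n - 2) * (n - 3) * (n - 4) * (n - 5) * (n - 6) / 5040 * (S7 - 7 * S6 + 21 * S5 - 35 * S4 + 35 * S3 - 21 * S2 +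 7 * S1 - X) + n * (n - 1) * (n - 2) * (n - 3) * (n - 4) * (n - 5) * (n - 6) * (n - 7) / 40320 * (S8 - 8 * S7 + 28 * S6 - 56 * S5 + 70 * S4 - 56 * S3 + 28 * S2 - 8 * S1 + X) - φ) * (40320 * D * E)
      = E * ninePwX q m * X + (E * ninePw0 q m - 40320 * D * ninePPhi q) := by
  linear_combination E * hA - 40320 * D * hB

set_option maxHeartbeats 1600000 in
set_option maxRecDepth 8192 in
/-- **The key identity**: on the untruncated regime `m + 8 ≤ q`, `(R̂(q,9,m) − Φ(q+9,q))·den = na·S(q,m) + nb`. -/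
theorem rhat_nine_key (q m : ℕ) (hm : m + 8 ≤ q) :
    (rhat q 9 m - phiK (q + 9) q) * denNine q m = naNine q m * sumS q m + nbNine q m := by
  rw [rhat_sub_phiK_eq_sumW q 9 m (by norm_num) (by omega)]
  have hB := nine_phi_eq q
  rw [sum_Ioo_nine (fun i => ((q + 9 - m).choose i : ℚ) * sumW q m i)]
  simp only [sumW_one, sumW_two, sumW_three, sumW_four, sumW_five, sumW_six, sumW_seven, sumW_eight]
  have hn : ((q + 9 - m : ℕ) : ℚ) = (q : ℚ) + 9 - m := by
    rw [Nat.cast_sub (by omega)]; push_cast; ring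
  rw [Nat.choose_one_right, choose_two_cast (q + 9 - m) (by omega), choose_three_cast (q + 9 - m) (by omega), choose_four_cast (q + 9 - m) (by omega), choose_five_cast (q + 9 - m) (by omega), choose_six_cast (q + 9 - m) (by omega), choose_seven_cast (q + 9 - m) (by omega), choose_eight_cast (q + 9 - m) (by omega), hn]
  have hS1 : ((q : ℚ) + m + 1) * sumS q (m + 1) = 2 * ((m : ℚ) + 1) * sumS q m + q := sumS_succ q m
  have hS2 : ((q : ℚ) + m + 2) * sumS q (m + 2) = 2 * ((m : ℚ) + 2) * sumS q (m + 1) + q := by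
    have := sumS_succ q (m + 1)
    rw [show m + 1 + 1 = m + 2 from rfl] at this
    push_cast at this
    linear_combination this
  have hS3 : ((q : ℚ) + m + 3) * sumS q (m + 3) = 2 * ((m : ℚ) + 3) * sumS q (m + 2) + q := by
    have := sumS_succ q (m + 2)
    rw [show m + 2 + 1 = m + 3 from rfl] at this
    push_cast at this
    linear_combination this
  have hS4 : ((q : ℚ) + m + 4) * sumS q (m + 4) = 2 * ((m : ℚ) + 4) * sumS q (m + 3) + q := by
    have := sumS_succ q (m + 3)
    rw [show m + 3 + 1 = m + 4 from rfl] at this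
    push_cast at this
    linear_combination this
  have hS5 : ((q : ℚ) + m + 5) * sumS q (m + 5) = 2 * ((m : ℚ) + 5) * sumS q (m + 4) + q := by
    have := sumS_succ q (m + 4)
    rw [show m + 4 + 1 = m + 5 from rfl] at this
    push_cast at this
    linear_combination this
  have hS6 : ((q : ℚ) + m + 6) * sumS q (m + 6) = 2 * ((m : ℚ) + 6) * sumS q (m + 5) + q := by
    have := sumS_succ q (m + 5)
    rw [show m + 5 + 1 = m + 6 from rfl] at this
    push_cast at this
    linear_combination this
  have hS7 : ((q : ℚ) + m + 7) * sumS q (m + 7) = 2 * ((m : ℚ) + 7) * sumS q (m + 6) + q := by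
    have := sumS_succ q (m + 6)
    rw [show m + 6 + 1 = m + 7 from rfl] at this
    push_cast at this
    linear_combination this
  have hS8 : ((q : ℚ) + m + 8) * sumS q (m + 8) = 2 * ((m : ℚ) + 8) * sumS q (m + 7) + q := by
    have := sumS_succ q (m + 7)
    rw [show m + 7 + 1 = m + 8 from rfl] at this
    push_cast at this
    linear_combination this
  have hA := nine_w_eq (q : ℚ) (m : ℚ) (sumS q m) (sumS q (m + 1)) (sumS q (m + 2)) (sumS q (m + 3)) (sumS q (m + 4)) (sumS q (m + 5)) (sumS q (m + 6)) (sumS q (m + 7)) (sumS q (m + 8)) ((q : ℚ) + 9 - m) (((q : ℚ) + m + 1) * ((q : ℚ) + m + 2) * ((q : ℚ) + m + 3) * ((q : ℚ) + m + 4) * ((q : ℚ) + m + 5) * ((q : ℚ) + m + 6) * ((q : ℚ) + m + 7) * ((q : ℚ) + m + 8)) rfl rfl hS1 hS2 hS3 hS4 hS5 hS6 hS7 hS8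
  have hden : denNine q m = 40320 * (((q : ℚ) + m + 1) * ((q : ℚ) + m + 2) * ((q : ℚ) + m + 3) * ((q : ℚ) + m + 4) * ((q : ℚ) + m + 5) * ((q : ℚ) + m + 6) * ((q : ℚ) + m + 7) * ((q : ℚ) + m + 8)) * (((q : ℚ) + 1) * ((q : ℚ) + 2) * ((q : ℚ) + 3) * ((q : ℚ) + 4) * ((q : ℚ) + 5) * ((q : ℚ) + 6) * ((q : ℚ) + 7) * ((q : ℚ) + 8)) := by
    unfold denNine; ring
  have hna : naNine q m = (((q : ℚ) + 1) * ((q : ℚ) + 2) * ((q : ℚ) + 3) * ((q : ℚ) + 4) * ((q : ℚ) + 5) * ((q : ℚ) + 6) * ((q : ℚ) + 7) * ((q : ℚ) + 8)) * ninePwX q m := by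
    unfold naNine ninePwX; ring
  have hnb : nbNine q m = (((q : ℚ) + 1) * ((q : ℚ) + 2) * ((q : ℚ) + 3) * ((q : ℚ) + 4) * ((q : ℚ) + 5) * ((q : ℚ) + 6) * ((q : ℚ) + 7) * ((q : ℚ) + 8)) * ninePw0 q m - 40320 * (((q : ℚ) + m + 1) * ((q : ℚ) + m + 2) * ((q : ℚ) + m + 3) * ((q : ℚ) + m + 4) * ((q : ℚ) + m + 5) * ((q : ℚ) + m + 6) * ((q : ℚ) + m + 7) * ((q : ℚ) + m + 8)) * ninePPhi q := by
    unfold nbNine ninePw0 ninePPhi; ring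
  rw [hden, hna, hnb]
  exact nine_final (q : ℚ) (m : ℚ) _ _ _ _ _ _ _ _ _ _ _ _ _ hA hB

end PercRepro
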